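import Summits.Ventures.YMGap.BEDoor.ClustersWith
import Literature.Analysis.Complex.SeveralVariables

/-!
# BEDoor / AnalyticStrip — §9a–c OSGOOD regularity from the tree + INPUT = P2's analyticity-strip predicate `QuasiLocalGaugePerturbation.HasAnalyticNormLE … stripDomain` LITERALLY
# (module 10/11 of the Bakry–Émery door, LIFT edition v8.3 = parts `Osgood` (v8.2 module 14), `AnalyticStrip` (v8.2 module 15); cell `ym-beyond`, seat P4)
STAGED EDITION (p4 g15, 2026-08-25T22:0xZ): = the FILED edition `ROUTE-P4Y2-Lift83-BEDoor-10-AnalyticStrip.lean` (sha16 013da4a7ffd78935) with ONE repair: the uses of the tree-PRIVATE `LatticeBakryEmery.expG` / `emb_expG` in `clustersWith_of_strip_hessian` (§9c; 4 term uses + 1 `simp only` unfold + 1 rewrite) now use a LOCAL private copy `expLoc` / `emb_expLoc` (same bodies) declared in §9b — the verbatim FILED edition fails behind the REAL `Thresholds.LatticeBakryEmeryConvolution` olean with «Unknown identifier `expG`» (certificate `p4-g15-files/FILED-REAL-LBE3-M04real.lean`, rc 1); nothing else touched.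

HONEST FRAMING (cell `ym-beyond`, seat P4 «Hessian-currency receiver», lens Y2; HUMAN RULINGS D-0035 / D-0037; memo `HOME/ROUTE-P4Y2.md` v8.1 +
g10 addendum, spec `HOME/ROUTE-P4Y2-LIFT-SPEC-v83.md`; LIFT edition v8.3 = the v8.2 module bodies of `HOME/ROUTE-P4Y2-Sketch.lean` v8.1, byte-identical and in
order, re-packed into 11 ≤ 400-line modules (fewer olean round-trips; director-ym line №2 (B)); the g10 appendix `OpenStrip` is a separate, UNQUEUED HOME file (line №3 (D))).  FINITE-LATTICE
statements at STRONG effective coupling: a RECEIVER («door») in HESSIAN (Bakry–Émery) currency for renormalisation-group output, typed over the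
tree's generic clustering chain `Thresholds/SharpClustering*` + `Thresholds/LatticeBakryEmery*`, complementary to the Dobrushin-currency door
`YM4Door/*` (LITERALLY the same INPUT predicate `QuasiLocalGaugePerturbation.HasAnalyticNormLE … stripDomain`, the same OUTPUT predicate
`RobustBall.ClustersWith`; no residual hypothesis: Osgood regularity is the tree's `Literature.Analysis.Complex.SCV.contDiffOn_infty`,
part `Osgood` of module `AnalyticStrip`).  Nothing here is a statement about `β → ∞`, the continuum limit or the Clay problem; NO effective action is asserted to be at
the door (that INPUT is not in print for `d = 4`); the verdict «the two windows do not meet» is unchanged in this currency.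
WHAT THIS IS NOT (ladder rung R2d; director-ym line №2 (B)): every door of this LIFT is an entry on the STRONG-COUPLING BANK of THE NUMBER —
finite-lattice exponential clustering at SMALL `|β|` and small strip norm `η` of the perturbation (`SU(2)`, `d = 4`: `16.2|β| + 4.4η < 1`, module `SU2`,
conclusion literally `RobustBall.ClustersWith`) — NOT clustering at weak coupling, NOT a statement at large `β`, NOT the mass gap.
No conjecture name, no `sorry`, no axiom beyond the standard three; every theorem is bookkeeping over the tree. [folklore]
References: H. Shen, R. Zhu, X. Zhu, CMP 400 (2023) 805 (arXiv:2204.12737) Thm 1.2, Cor. 4.4/4.11; D. Bakry, M. Émery, LNM 1123 (1985);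
T. Bałaban, CMP 109 (1987) 249, (1.18)–(1.22) (analyticity format); L. Hörmander, An Introduction to Complex Analysis in Several Variables
(1973) Thm 2.2.1/2.2.6 (Osgood); E. J. McShane, Bull. AMS 40 (1934) 837 (Lipschitz extension).

THIS MODULE, part `Osgood` (§9a OSGOOD REGULARITY from the TREE (`osgood_contDiffOn` := `Literature.Analysis.Complex.SCV.contDiffOn_infty`; v8.1,
referee flag F-P4b)): `osgood_contDiffOn` (`IsOpen s → DifferentiableOn ℂ f s → ContDiffOn ℂ ∞ f s` for `f : E → ℂ`, `E` a finite-dimensional complex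
normed space) and `osgood_contDiffOn_real` (the `ℝ`-smooth form the door consumes) — both ALIASES of the tree theorem
`Literature.Analysis.Complex.SCV.contDiffOn_infty` (holomorphic in several variables ⇒ `C^∞`; Osgood's lemma proper, holomorphic ⇒ analytic, is the
tree's `Literature.Analysis.Complex.SCV.analyticOnNhd_of_differentiableOn` / named fact `osgoodLemma`, `OsgoodProofs.lean`).  This module adds the
import `Literature.Analysis.Complex.SeveralVariables` to the chain; the filer may instead inline the two aliases at the top of `AnalyticStrip.lean`
(the only call site) and drop this file.

THIS MODULE, part `AnalyticStrip` (§9b–c INPUT = P2's analyticity-strip predicate `QuasiLocalGaugePerturbation.HasAnalyticNormLE … stripDomain`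
LITERALLY: the Hessian door LIKE-FOR-LIKE with `YM4Door/StripDoor`): `card_polymerEdges_one`, `torusNorm_le_polymerDiam`, `exp_sub_one_le_mul_exp`,
`sq_mul_exp_neg_le`, `RobustBall.ClustersWith.mono_const`; ★★★ `clustersWith_of_strip_hessian` (every `N ≥ 1`, `d`, `L ≥ 2`: `W.HasAnalyticNormLE
(fundamentalRep) (strip r) κ η` + thin supports ⇒ ∀ `0 ≤ κ' < κ`, `0 < r'' < log(1+r)`: door `N/2 − (N|β|Λ₀ + 2η/r''²) − (max(6(d−1)N|β|,0)(e^{κ'} −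
1) + 16dκ'η/(e²r''²(κ−κ')²)) > 0 ⇒ ClustersWith W (Nβ) K⁻¹ κ'`; no residual hypothesis — smoothness of the holomorphic extensions by
`osgood_contDiffOn` = the tree's `SCV.contDiffOn_infty`).
-/

noncomputable section

open scoped Matrix ComplexConjugate BigOperators Matrix.Norms.Frobenius ContDiff Topology
open Matrix Complex Finset MeasureTheory Filter
open Literature.MathematicalPhysics.QuantumFieldTheory
open Literature.MathematicalPhysics.QuantumFieldTheory.SUNBakryEmery (SUN FrameIdx frame)

namespace Summit.Ventures.YMGap.BEDoor

open Summit.Ventures.YMGap Summit.Ventures.YMGap.LatticeBakryEmery Summit.Ventures.YMGap.SharpClustering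
open Summit.Ventures.YMGap.HessianSharp

universe u

/-! ## ── part 14 · `Osgood` — §9a OSGOOD REGULARITY from the TREE (`osgood_contDiffOn` := `Literature.Analysis.Complex.SCV.contDiffOn_infty`… ── -/

section Osgood

/-! ### §9a. OSGOOD REGULARITY — IN THE TREE (v8.1).  A Fréchet-holomorphic function on an open subset of a finite-dimensional complex normed
space is `C^∞`: this is the tree theorem `Literature.Analysis.Complex.SCV.contDiffOn_infty` (`Literature/Analysis/Complex/SeveralVariables.lean`,
in the tree since 2026-08-14; Osgood's lemma proper — holomorphic ⇒ analytic — is `Literature.Analysis.Complex.SCV.analyticOnNhd_of_differentiableOn`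
in `OsgoodProofs.lean`, discharging the named fact `Literature.Analysis.Complex.osgoodLemma`; referee flag F-P4b).  v8 carried its own ≈ 230-line
Mathlib-only proof of the `C^∞` form at this place (kept for the record as `HOME/ROUTE-P4Y2-Sketch-v8.lean` §9a, farm rc 0);
v8.1 replaces it by the two aliases below so that nothing duplicates a landed tree theorem.  The door's call site (§9c `clustersWith_of_strip_hessian`)
is unchanged. -/

variable {E : Type*} [NormedAddCommGroup E] [NormedSpace ℂ E] [FiniteDimensional ℂ E]

/-- **Osgood regularity** (alias of the tree's `Literature.Analysis.Complex.SCV.contDiffOn_infty`): a Fréchet-holomorphic function on an open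
subset of a finite-dimensional complex normed space is `C^∞` over `ℂ`. [folklore] -/
theorem osgood_contDiffOn {f : E → ℂ} {s : Set E} (hs : IsOpen s) (hf : DifferentiableOn ℂ f s) :
    ContDiffOn ℂ ∞ f s :=
  Literature.Analysis.Complex.SCV.contDiffOn_infty hf hs

/-- Real form: `C^∞` over `ℝ`. [folklore] -/
theorem osgood_contDiffOn_real {f : E → ℂ} {s : Set E} (hs : IsOpen s) (hf : DifferentiableOn ℂ f s) :
    ContDiffOn ℝ ∞ f s :=
  (osgood_contDiffOn hs hf).restrict_scalars ℝ

end Osgood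

/-! ## ── part 15 · `AnalyticStrip` — §9b–c INPUT = P2's analyticity-strip predicate `QuasiLocalGaugePerturbation.HasAnalyticNormLE … stripDomain` L… ── -/

section AnalyticInput

variable {d N : ℕ} {L : ℕ} [NeZero L]

open scoped ProbabilityTheory
open ProbabilityTheory
open Literature.MathematicalPhysics.QuantumLattice (fundamentalRep fundamentalRep_apply)

/-! ### §9b. Block-scale-one combinatorics, two real inequalities, monotonicity of `ClustersWith`
(STAGED v2, p4 g15: the four generic lemmas below are `private` — the gate's `dedup.landed` bounces public one-liners whose
normalised statement equals a landed one anywhere in the tree, cf. `exp_sub_one_le_mul_exp` in three other summits' files.) -/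

/-- At block scale `1` the links of a polymer are `X × (directions)`: `|X̃| = |X| · d`. [folklore] -/
private theorem card_polymerEdges_one (X : Finset (Site d L)) : (polymerEdges (d := d) (L := L) 1 X).card = X.card * d := by
  have h : polymerEdges (d := d) (L := L) 1 X = X ×ˢ (Finset.univ : Finset (Fin d)) := by
    ext e
    simp [mem_polymerEdges_iff, Finset.mem_product]
  rw [h, Finset.card_product, Finset.card_univ, Fintype.card_fin]

omit [NeZero L] in
/-- Two sites of a polymer are at torus distance at most its diameter. [folklore] -/
private theorem torusNorm_le_polymerDiam {X : Finset (Site d L)} {x y : Site d L} (hx : x ∈ X) (hy : y ∈ X) :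
    torusNorm (x - y) ≤ RobustBall.polymerDiam X :=
  (Finset.le_sup (f := fun y => torusNorm (x - y)) hy).trans
    (Finset.le_sup (f := fun x => X.sup fun y => torusNorm (x - y)) hx)

/-- `e^x − 1 ≤ x e^x` for `x ≥ 0`. [folklore] -/
private theorem exp_sub_one_le_mul_exp {x : ℝ} (hx : 0 ≤ x) : Real.exp x - 1 ≤ x * Real.exp x := by
  have h := Real.add_one_le_exp (-x)
  have h0 := hx
  have hx' : Real.exp (-x) * Real.exp x = 1 := by rw [← Real.exp_add, neg_add_cancel, Real.exp_zero]
  nlinarith [Real.exp_pos x, Real.exp_pos (-x)]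

/-- `t² e^{−ct} ≤ 4/(e² c²)` for `t ≥ 0`, `c > 0` (maximum at `t = 2/c`). [folklore] -/
private theorem sq_mul_exp_neg_le {t c : ℝ} (ht : 0 ≤ t) (hc : 0 < c) :
    t ^ 2 * Real.exp (-(c * t)) ≤ 4 / (Real.exp 2 * c ^ 2) := by
  have hu : c * t / 2 ≤ Real.exp (c * t / 2 - 1) := by
    have := Real.add_one_le_exp (c * t / 2 - 1); linarith
  have hsq : (c * t / 2) ^ 2 ≤ Real.exp (c * t / 2 - 1) ^ 2 := pow_le_pow_left₀ (by positivity) hu 2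
  have hexp : Real.exp (c * t / 2 - 1) ^ 2 * Real.exp 2 = Real.exp (c * t) := by
    rw [sq, ← Real.exp_add, ← Real.exp_add]; ring_nf
  rw [le_div_iff₀ (by positivity)]
  calc t ^ 2 * Real.exp (-(c * t)) * (Real.exp 2 * c ^ 2)
      = 4 * ((c * t / 2) ^ 2 * Real.exp 2) * Real.exp (-(c * t)) := by ring
    _ ≤ 4 * (Real.exp (c * t / 2 - 1) ^ 2 * Real.exp 2) * Real.exp (-(c * t)) := by gcongr
    _ = 4 := by rw [hexp, mul_assoc, ← Real.exp_add, add_neg_cancel, Real.exp_zero, mul_one]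

/-- LOCAL COPY (STAGED edition, p4 g15, 2026-08-25): the tree's `LatticeBakryEmery.expG`
(`Thresholds/LatticeBakryEmeryConvolution.lean` :231, p401598) is `private`, hence NOT nameable from this module once that file is
`import`ed (the cell's check files INLINED its source, which hid the privacy); same body, local name.  The one-parameter subgroup of
`SU(N)^ι` generated by `V ∈ 𝔰𝔲(N)^ι`. [folklore] -/
private def expLoc {ι : Type u} (V : Cfg ι N) (hV : ∀ e, (V e)ᴴ = -V e) (hV0 : ∀ e, (V e).trace = 0) (t : ℝ) : PSU ι N :=
  fun e => SUNBakryEmery.expSU (hV e) (hV0 e) t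

/-- `emb (expLoc V t) = exp(tV)` in the product algebra (= the tree's public `LatticeBakryEmery.emb_expG`, whose statement mentions the
private `expG`; restated for the local copy, same three-line proof). [folklore] -/
private theorem emb_expLoc {ι : Type u} [Fintype ι] (V : Cfg ι N) (hV : ∀ e, (V e)ᴴ = -V e) (hV0 : ∀ e, (V e).trace = 0) (t : ℝ) :
    emb (expLoc V hV hV0 t) = NormedSpace.exp (t • V) := by
  rw [show NormedSpace.exp (t • V) = fun i => NormedSpace.exp ((t • V) i) from Pi.exp_def _]
  funext e
  simp [emb, expLoc, Pi.smul_apply]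

open Literature.Probability.LatticeModels.DobrushinMetric (IsLipBound) in
/-- `ClustersWith` is monotone in the amplitude constant. [folklore] -/
theorem _root_.Summit.Ventures.YMGap.RobustBall.ClustersWith.mono_const {W : RobustBall.Perturbation d L N} {β A A' m : ℝ}
    (h : RobustBall.ClustersWith W β A m) (hA : A ≤ A') : RobustBall.ClustersWith W β A' m := by
  intro f g Δf Δg δf δg n hfm hgm hfdep hgdep hfb hgb hfL hgL hsep
  refine (h f g Δf Δg δf δg n hfm hgm hfdep hgdep hfb hgb hfL hgL hsep).trans ?_
  have h1 : 0 ≤ ∑ y ∈ Δg, δg y := sum_nonneg fun y _ => hgL.nonneg y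
  have h2 : 0 ≤ ∑ x ∈ Δf, δf x := sum_nonneg fun x _ => hfL.nonneg x
  have h3 : 0 ≤ Real.exp (-m * n) := (Real.exp_pos _).le
  have := mul_le_mul_of_nonneg_right (mul_le_mul_of_nonneg_right (mul_le_mul_of_nonneg_right hA h1) h2) h3
  exact this

/-! ### §9c. ★★★ The Hessian door from the strip predicate -/

/-- ★★★ **THE HESSIAN DOOR, LITERALLY LIKE-FOR-LIKE with P2's Dobrushin door, every `N ≥ 1`, `d`, `L ≥ 2`.**  INPUT: a member `W`
of the robustness ball whose activities satisfy P2's weighted analyticity-strip bound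
`W.HasAnalyticNormLE (fundamentalRep (Fin N)) (fun _ => stripDomain _ r) κ η` and have thin supports (`diam X ≤ |X| − 1` whenever `W_X ≠ 0`).
OUTPUT: for every rate `0 ≤ κ' < κ` and every `0 < r'' < log (1 + r)`, if the door
`K := N/2 − (N|β|Λ₀ + 2η/r''²) − (max(6(d−1)N|β|,0)(e^{κ'} − 1) + 16 d κ' η/(e² r''² (κ−κ')²)) > 0`
is open then `ClustersWith W (Nβ) K⁻¹ κ'`.  No residual hypothesis (smoothness of the holomorphic extensions by §9a `osgood_contDiffOn`).
[folklore assembly: §9a Osgood, §9b cutoff and frozen flows ⇒ §8c] [folklore] -/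
theorem clustersWith_of_strip_hessian {Λ₀ : ℝ} (hH : WilsonHessianBound d N Λ₀) (hN : N ≠ 0) (β : ℝ) (hL : 1 < L)
    (W : RobustBall.Perturbation d L N) {r κ κ' η : ℝ} (hr : 0 < r)
    (hW : W.HasAnalyticNormLE (fundamentalRep (Fin N)) (fun _ => stripDomain (d := d) (L := L) (fundamentalRep (Fin N)) r) κ η)
    (hsupp : ∀ X, W.act X ≠ 0 → (RobustBall.polymerDiam X : ℝ) ≤ (X.card : ℝ) - 1)
    (hκ' : 0 ≤ κ') (hκ : κ' < κ) {r'' : ℝ} (hr''0 : 0 < r'') (hr'' : r'' < Real.log (1 + r))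
    (hK : 0 < (N : ℝ) / 2 - ((N : ℝ) * |β| * Λ₀ + 2 * η / r'' ^ 2) -
      (max (6 * ((d : ℝ) - 1) * N * |β|) 0 * (Real.exp κ' - 1) +
        16 * d * κ' * η / (Real.exp 2 * r'' ^ 2 * (κ - κ') ^ 2))) :
    RobustBall.ClustersWith W ((N : ℝ) * β)
      (1 / ((N : ℝ) / 2 - ((N : ℝ) * |β| * Λ₀ + 2 * η / r'' ^ 2) -
        (max (6 * ((d : ℝ) - 1) * N * |β|) 0 * (Real.exp κ' - 1) +
          16 * d * κ' * η / (Real.exp 2 * r'' ^ 2 * (κ - κ') ^ 2)))) κ' := by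
  classical
  set ρ : SUN N →* Matrix (Fin N) (Fin N) ℂ := fundamentalRep (Fin N) with hρ
  obtain ⟨M, hA, hsum⟩ := hW
  have hκ0 : 0 ≤ κ := hκ'.trans hκ.le
  -- the holomorphic extensions (arbitrary off `polymers 1`)
  have hA' : ∀ X : Finset (Site d L), ∃ F : ComplexGaugeConfig d L N → ℂ, X ∈ polymers (d := d) (L := L) 1 →
      DifferentiableOn ℂ F (stripDomain ρ r) ∧
        (∀ U : PSU (Edge d L) N, complexify ρ U ∈ stripDomain ρ r → F (complexify ρ U) = W.act X U) ∧
        ∀ Z ∈ stripDomain ρ r, ‖F Z‖ ≤ M X := by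
    intro X
    by_cases hX : X ∈ polymers (d := d) (L := L) 1
    · obtain ⟨F, h⟩ := hA X hX
      exact ⟨F, fun _ => h⟩
    · exact ⟨0, fun h => absurd h hX⟩
  choose F hF using hA'
  have hcx : ∀ U : PSU (Edge d L) N, complexify ρ U = emb U := fun U => rfl
  have hstripU : ∀ U : PSU (Edge d L) N, complexify ρ U ∈ stripDomain ρ r := fun U => complexify_mem_stripDomain ρ hr U
  -- the cutoff
  obtain ⟨χ, hχ, hχ1, hχs⟩ := exists_contDiff_cutoff (E := ComplexGaugeConfig d L N)
    (Set.range (complexify (d := d) (L := L) ρ)) hr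
  have hχs' : tsupport χ ⊆ stripDomain ρ r := hχs
  have hχU : ∀ U : PSU (Edge d L) N, χ (emb U) = 1 := fun U => hχ1 _ ⟨U, hcx U⟩
  -- the smooth real terms
  set E : Finset (Site d L) → Cfg (Edge d L) N → ℝ :=
    fun X Z => if X ∈ polymers (d := d) (L := L) 1 then χ Z * -(F X Z).re else 0 with hE
  have hEsm : ∀ X, ContDiff ℝ ∞ (E X) := by
    intro X
    by_cases hX : X ∈ polymers (d := d) (L := L) 1
    · have h1 : ContDiffOn ℝ ∞ (fun Z => -(F X Z).re) (stripDomain ρ r) := by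
        have hc : ContDiffOn ℂ ∞ (F X) (stripDomain ρ r) :=
          osgood_contDiffOn (isOpen_stripDomain ρ r) (hF X hX).1
        have hcR : ContDiffOn ℝ ∞ (F X) (stripDomain ρ r) := hc.restrict_scalars ℝ
        exact (Complex.reCLM.contDiff.comp_contDiffOn hcR).neg
      have h2 := contDiff_mul_of_tsupport_subset (isOpen_stripDomain ρ r) hχ hχs' h1
      simp only [hE, hX, if_true]
      exact h2
    · simp only [hE, hX, if_false]
      exact contDiff_const
  -- the index set: active polymers
  set s : Finset (Finset (Site d L)) := (polymers (d := d) (L := L) 1).filter fun X => W.act X ≠ 0 with hs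
  have hs_sub : ∀ X ∈ s, X ∈ polymers (d := d) (L := L) 1 := fun X hX => (mem_filter.1 hX).1
  have hs_act : ∀ X ∈ s, W.act X ≠ 0 := fun X hX => (mem_filter.1 hX).2
  set Xe : Finset (Site d L) → Finset (Edge d L) := fun X => polymerEdges (d := d) (L := L) 1 X with hXe
  have hXe_mem : ∀ (X : Finset (Site d L)) (e : Edge d L), e ∈ Xe X ↔ e.1 ∈ X := fun X e => by
    simp [hXe, mem_polymerEdges_iff]
  have hM0 : ∀ X ∈ polymers (d := d) (L := L) 1, 0 ≤ M X := fun X hX =>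
    (norm_nonneg _).trans ((hF X hX).2.2 _ (hstripU 1))
  -- (hW) the terms restrict to `−W.total`
  have hWsum : ∀ U : PSU (Edge d L) N, (∑ X ∈ s, E X) (emb U) = -W.total U := by
    intro U
    rw [Finset.sum_apply]
    have h1 : ∀ X ∈ s, E X (emb U) = -W.act X U := by
      intro X hX
      have hXp := hs_sub X hX
      simp only [hE, hXp, if_true]
      rw [hχU U, one_mul, ← hcx U, (hF X hXp).2.1 U (hstripU U), Complex.ofReal_re]
    rw [Finset.sum_congr rfl h1, Finset.sum_neg_distrib]
    simp only [QuasiLocalGaugePerturbation.total, hs]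
    rw [Finset.sum_filter_of_ne]
    intro X _ hne h0
    exact hne (by rw [h0]; rfl)
  -- (hSB) the strip-format certificate of every term: frozen flows
  have hSB : ∀ X ∈ s, StripBoundOn (E X) (Xe X) (M X) r'' := by
    intro X hX g V hV hV0 hV1
    have hXp := hs_sub X hX
    have hV1' : ∀ e ∈ Xe X, ‖V e‖ ≤ 1 := by
      intro e he
      have h1 : frobNorm (V e) ^ 2 ≤ 1 :=
        (Finset.single_le_sum (fun e' _ => sq_nonneg (frobNorm (V e'))) he).trans hV1
      rw [frobNorm_eq_norm] at h1
      exact (sq_le_one_iff₀ (norm_nonneg _)).1 h1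
    have hPstrip : ∀ z : ℂ, ‖z‖ < Real.log (1 + r) → flowCfg g V (Xe X) z ∈ stripDomain ρ r := fun z hz =>
      (mem_stripDomain_iff_forall ρ hr).2 ⟨g, fun e => by
        rw [hρ, fundamentalRep_apply]; exact norm_flowCfg_sub_lt g hV1' hr hz e⟩
    refine ⟨fun z => -(F X (flowCfg g V (Xe X) z)), ?_, ?_, ?_⟩
    · have hdiff : DifferentiableOn ℂ (fun z => -(F X (flowCfg g V (Xe X) z))) (Metric.ball 0 (Real.log (1 + r))) := by
        refine ((hF X hXp).1.comp (differentiable_flowCfg g V (Xe X)).differentiableOn ?_).neg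
        intro z hz
        exact hPstrip z (mem_ball_zero_iff.1 hz)
      refine DifferentiableOn.diffContOnCl (hdiff.mono ?_)
      exact Metric.closure_ball_subset_closedBall.trans (Metric.closedBall_subset_ball hr'')
    · intro z hz
      have hz' : ‖z‖ < Real.log (1 + r) := by rw [mem_sphere_zero_iff_norm.1 hz]; exact hr''
      rw [norm_neg]
      exact (hF X hXp).2.2 _ (hPstrip z hz')
    · intro t _
      have hflow : flowCfg g V (Xe X) (t : ℂ) = emb (flowPSU g V hV hV0 (Xe X) t) := flowCfg_ofReal g V hV hV0 (Xe X) t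
      have hgrp : emb g * NormedSpace.exp (t • V) = emb (g * expLoc V hV hV0 t) := by rw [emb_mul, emb_expLoc]
      have hdep : W.act X (flowPSU g V hV hV0 (Xe X) t) = W.act X (g * expLoc V hV hV0 t) := by
        refine W.dependsOn' X (fun e he => ?_)
        have he' : e ∈ Xe X := he
        simp only [flowPSU, he', if_true, expLoc, Pi.mul_apply]
      have h1 : F X (flowCfg g V (Xe X) (t : ℂ)) = (W.act X (g * expLoc V hV hV0 t) : ℂ) := by
        rw [hflow, ← hcx, (hF X hXp).2.1 _ (hstripU _), hdep]
      have h2 : E X (emb g * NormedSpace.exp (t • V)) = -W.act X (g * expLoc V hV hV0 t) := by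
        simp only [hE, hXp, if_true]
        rw [hgrp, hχU, one_mul, ← hcx, (hF X hXp).2.1 _ (hstripU _), Complex.ofReal_re]
      show -(F X (flowCfg g V (Xe X) (t : ℂ))) = _
      rw [h1, h2, Complex.ofReal_neg]
  -- block scale one: every site is a block corner
  have hbc : ∀ y : Site d L, y ∈ blockCorners (d := d) (L := L) 1 := fun y => by
    simp only [blockCorners, Finset.mem_image, Finset.mem_univ, true_and]
    exact ⟨y, blockCorner_one y⟩
  -- enlarging a sum over active polymers through a link to all polymers through its base point
  have hthrough : ∀ (e : Edge d L) (φ : Finset (Site d L) → ℝ),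
      (∀ X ∈ polymers (d := d) (L := L) 1, e.1 ∈ X → 0 ≤ φ X) →
      ∑ X ∈ s, (if e ∈ Xe X then φ X else 0) ≤ ∑ X ∈ polymersThrough (d := d) (L := L) 1 e.1, φ X := by
    intro e φ hφ
    calc ∑ X ∈ s, (if e ∈ Xe X then φ X else 0)
        ≤ ∑ X ∈ polymers (d := d) (L := L) 1, (if e ∈ Xe X then φ X else 0) := by
          refine Finset.sum_le_sum_of_subset_of_nonneg (filter_subset _ _) fun X hX _ => ?_
          by_cases he : e ∈ Xe X
          · rw [if_pos he]; exact hφ X hX ((hXe_mem X e).1 he)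
          · rw [if_neg he]
      _ = ∑ X ∈ polymersThrough (d := d) (L := L) 1 e.1, φ X := by
          rw [polymersThrough, Finset.sum_filter]
          exact Finset.sum_congr rfl fun X _ => by simp only [hXe_mem]
  -- (hη) the Hessian load
  have hη' : ∀ e, hessLoad s Xe (fun X => 2 * M X / r'' ^ 2) e ≤ 2 * η / r'' ^ 2 := by
    intro e
    have h1 := hthrough e (fun X => 2 * M X / r'' ^ 2) (fun X hX _ => by have := hM0 X hX; positivity)
    have h3 : ∑ X ∈ polymersThrough (d := d) (L := L) 1 e.1, M X ≤ η := by
      refine le_trans (Finset.sum_le_sum fun X hX => ?_) (hsum e.1 (hbc e.1))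
      have hXp : X ∈ polymers (d := d) (L := L) 1 := (mem_polymersThrough_iff.1 hX).1
      exact le_mul_of_one_le_right (hM0 X hXp) (Real.one_le_exp (by positivity))
    unfold hessLoad
    calc ∑ X ∈ s, (if e ∈ Xe X then 2 * M X / r'' ^ 2 else 0)
        ≤ ∑ X ∈ polymersThrough (d := d) (L := L) 1 e.1, 2 * M X / r'' ^ 2 := h1
      _ = 2 / r'' ^ 2 * ∑ X ∈ polymersThrough (d := d) (L := L) 1 e.1, M X := by
          rw [Finset.mul_sum]; exact Finset.sum_congr rfl fun _ _ => by ring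
      _ ≤ 2 / r'' ^ 2 * η := mul_le_mul_of_nonneg_left h3 (by positivity)
      _ = 2 * η / r'' ^ 2 := by ring
  -- (hδ) the oscillation bound from thin supports
  have hδ' : ∀ X ∈ s, ∀ e ∈ Xe X, ∀ e' ∈ Xe X, (torusNorm (e.1 - e'.1) : ℝ) ≤ (X.card : ℝ) - 1 := by
    intro X hX e he e' he'
    have h1 : torusNorm (e.1 - e'.1) ≤ RobustBall.polymerDiam X :=
      torusNorm_le_polymerDiam ((hXe_mem X e).1 he) ((hXe_mem X e').1 he')
    exact (Nat.cast_le.2 h1).trans (hsupp X (hs_act X hX))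
  -- (hΘ) the inhomogeneity load
  have hΘ' : ∀ e, ∑ X ∈ s, (if e ∈ Xe X then
      4 * M X / r'' ^ 2 * (Xe X).card * (Real.exp (κ' * ((X.card : ℝ) - 1)) - 1) else 0) ≤
      16 * d * κ' * η / (Real.exp 2 * r'' ^ 2 * (κ - κ') ^ 2) := by
    intro e
    set C : ℝ := 16 * d * κ' / (Real.exp 2 * r'' ^ 2 * (κ - κ') ^ 2) with hC
    have hC0 : 0 ≤ C := by positivity
    have hc : 0 < κ - κ' := by linarith
    have hterm : ∀ X ∈ polymersThrough (d := d) (L := L) 1 e.1,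
        4 * M X / r'' ^ 2 * (Xe X).card * (Real.exp (κ' * ((X.card : ℝ) - 1)) - 1) ≤
          C * (M X * Real.exp (κ * X.card)) := by
      intro X hX
      obtain ⟨hXp, heX⟩ := mem_polymersThrough_iff.1 hX
      have hMX := hM0 X hXp
      have ht1 : (1 : ℝ) ≤ X.card := by exact_mod_cast Finset.card_pos.2 ⟨e.1, heX⟩
      have hcard : ((Xe X).card : ℝ) = X.card * d := by
        rw [show (Xe X).card = X.card * d from card_polymerEdges_one X]; push_cast; ring
      have h1 : Real.exp (κ' * ((X.card : ℝ) - 1)) - 1 ≤ κ' * X.card * Real.exp (κ' * X.card) := by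
        have ha : 0 ≤ κ' * ((X.card : ℝ) - 1) := mul_nonneg hκ' (by linarith)
        calc Real.exp (κ' * ((X.card : ℝ) - 1)) - 1
            ≤ κ' * ((X.card : ℝ) - 1) * Real.exp (κ' * ((X.card : ℝ) - 1)) := exp_sub_one_le_mul_exp ha
          _ ≤ κ' * X.card * Real.exp (κ' * X.card) := by
              refine mul_le_mul ?_ (Real.exp_le_exp.2 ?_) (Real.exp_pos _).le (by positivity)
              · nlinarith
              · nlinarith
      have h2 : (X.card : ℝ) ^ 2 * Real.exp (-((κ - κ') * X.card)) ≤ 4 / (Real.exp 2 * (κ - κ') ^ 2) :=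
        sq_mul_exp_neg_le (by positivity) hc
      calc 4 * M X / r'' ^ 2 * (Xe X).card * (Real.exp (κ' * ((X.card : ℝ) - 1)) - 1)
          ≤ 4 * M X / r'' ^ 2 * (Xe X).card * (κ' * X.card * Real.exp (κ' * X.card)) :=
            mul_le_mul_of_nonneg_left h1 (by positivity)
        _ = 4 * d * κ' / r'' ^ 2 * M X * ((X.card : ℝ) ^ 2 * Real.exp (-((κ - κ') * X.card))) *
              Real.exp (κ * X.card) := by
            rw [hcard, show κ' * (X.card : ℝ) = -((κ - κ') * X.card) + κ * X.card by ring, Real.exp_add]; ring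
        _ ≤ 4 * d * κ' / r'' ^ 2 * M X * (4 / (Real.exp 2 * (κ - κ') ^ 2)) * Real.exp (κ * X.card) := by
            gcongr
        _ = C * (M X * Real.exp (κ * X.card)) := by
            have hr0 : r'' ≠ 0 := hr''0.ne'
            have hc0 : κ - κ' ≠ 0 := hc.ne'
            rw [hC]; field_simp; ring
    calc ∑ X ∈ s, (if e ∈ Xe X then
            4 * M X / r'' ^ 2 * (Xe X).card * (Real.exp (κ' * ((X.card : ℝ) - 1)) - 1) else 0)
        ≤ ∑ X ∈ polymersThrough (d := d) (L := L) 1 e.1,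
            4 * M X / r'' ^ 2 * (Xe X).card * (Real.exp (κ' * ((X.card : ℝ) - 1)) - 1) := by
          refine hthrough e _ fun X hX heX => ?_
          have hMX := hM0 X hX
          have ht1 : (1 : ℝ) ≤ X.card := by exact_mod_cast Finset.card_pos.2 ⟨e.1, heX⟩
          have : 0 ≤ Real.exp (κ' * ((X.card : ℝ) - 1)) - 1 := by
            have := Real.one_le_exp (mul_nonneg hκ' (by linarith : (0 : ℝ) ≤ (X.card : ℝ) - 1)); linarith
          positivity
      _ ≤ ∑ X ∈ polymersThrough (d := d) (L := L) 1 e.1, C * (M X * Real.exp (κ * X.card)) := Finset.sum_le_sum hterm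
      _ = C * ∑ X ∈ polymersThrough (d := d) (L := L) 1 e.1, M X * Real.exp (κ * X.card) := by rw [Finset.mul_sum]
      _ ≤ C * η := mul_le_mul_of_nonneg_left (hsum e.1 (hbc e.1)) hC0
      _ = 16 * d * κ' * η / (Real.exp 2 * r'' ^ 2 * (κ - κ') ^ 2) := by rw [hC]; ring
  -- §8c
  exact clustersWith_of_format hH hN β hL W s hEsm hWsum hr''0 (fun X hX => hM0 X (hs_sub X hX)) hSB hη' hκ'
    (δ := fun X => (X.card : ℝ) - 1) hδ' hΘ' hK

end AnalyticInput

end Summit.Ventures.YMGap.BEDoor
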